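import Summits.CriticalPhenomena.PercolationContinuityZ3.Theorems.PercGamblersRuinVerticalGamblersRuinDeterministicTime

/-!
# Route `PercGamblersRuin`, crux `VerticalGamblersRuin` (stmt-CriticalPhenomena-10642):
# stub `stub_forwardKolmogorov` — quenched Kolmogorov maximal inequality for the forward martingale

Helper file for the stub `stub_forwardKolmogorov` of the line `registered` (skeleton rev 8, the
deterministic-time criterion / Lyons–Zheng exit-time bound) of the crux
`PercGamblersRuin.VerticalGamblersRuin`.

Setting (QUENCHED: the configuration `ω` is fixed, no measure theory).  `N_ω(x)` is the set of
lattice neighbours `y ∼ x` of `ℤ³` with `s(x, y)` open in `ω`; the height is `h z = z₀`; the local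
vertical DRIFT of the simple random walk on the open lattice edges is
`D ω z = (∑_{y ∈ N_ω(z)} (h y - h z)) / #N_ω(z)` (pinned by `hD`, `0/0 = 0`); the PATH FUNCTIONAL
`E ω T x G = E^ω_x[G [X_0, …, X_T]]` is pinned by the first-step recursion
`hE0 : E ω 0 x G = G [x]` and
`hEs : E ω (T+1) x G = (∑_{y ∈ N_ω(x)} E ω T y (l ↦ G (x :: l))) / #N_ω(x)`.
For a path `l = [x_0, …, x_T]` the FORWARD MARTINGALE is `M_t(l) = h x_t - h x_0 - ∑_{s<t} D ω x_s`.

Statement proved (exact registered signature): for `λ > 0` and a start `x` with an open lattice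
neighbour, `λ² · E ω T x (1_{∃ t ≤ T, λ ≤ |M_t|}) ≤ 4T`.

Proof (no stopping times; everything about `E` by induction on `T` from `hE0`/`hEs`, in the
abstract setting of a symmetric neighbour structure `N` on a type `V`, a height `hgt` with
`|hgt y - hgt x| ≤ 1` for `y ∈ N x`, and the drift `d x = (∑_{y ∈ N x} (hgt y - hgt x)) / #N x`).
Replace `h x_0` by a free OFFSET `a`: `M^a_t(l) = hgt x_t - a - ∑_{s<t} d x_s`.  CONSING:
`M^a_0(x :: l) = hgt x - a` and `M^a_{t+1}(x :: l) = M^{a + d x}_t(l)`, so the exceedance indicator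
of `x :: l` is `1` if `λ ≤ |hgt x - a|` and the exceedance indicator of `l` with offset `a + d x`
otherwise.  By induction on `T`, for starts with `N x ≠ ∅` (inherited by the neighbours, `N`
being symmetric): MASS `E[1] = 1`; SECOND MOMENT `(hgt x - a)² ≤ E[(M^a_T)²] ≤ (hgt x - a)² + 4T`
from the ORTHOGONALITY `∑_{y ∈ N x} (hgt y - a - d x)² = #N x · (hgt x - a)² + ∑_{y ∈ N x}
(hgt y - hgt x - d x)²` (the cross term vanishes by the definition of `d x`) and
`|hgt y - hgt x - d x| ≤ 2`; KOLMOGOROV `λ² E[1_{∃ t, λ ≤ |M^a_t|}] ≤ E[1_{…} (M^a_T)²]`: if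
`λ ≤ |hgt x - a|` the indicator is `1` on every path and `λ² ≤ (hgt x - a)² ≤ E[(M^a_T)²]`,
otherwise both sides are first-step averages of the same quantities at `(y, a + d x)`.  Finally
`E[1_{…} (M_T)²] ≤ E[(M_T)²]` (monotonicity) and `a := hgt x`.

## References

* R. Lyons, Y. Peres, *Probability on Trees and Networks*, Cambridge University Press (2016),
  §2.1 and §13 (forward/backward martingale decomposition, Lyons–Zheng).
* D. Williams, *Probability with Martingales*, Cambridge University Press (1991), §14.6
  (Kolmogorov's inequality by first-step/optional decomposition).
-/

noncomputable section

namespace Summit.CriticalPhenomena.PercolationContinuityZ3.Theorems.VerticalGamblersRuin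

open MeasureTheory Filter Topology
open Literature.Probability.Percolation Literature.Probability.LatticeModels
open scoped Classical

namespace StubForwardKolmogorov

variable {V : Type*} {v₀ : V} {N : V → Finset V} {F : ℕ → V → (List V → ℝ) → ℝ}
  {hgt d : V → ℝ} {lam : ℝ} {Mf : ℝ → ℕ → List V → ℝ} {ind : ℝ → List V → ℝ}

/-! ### The path functional pinned by its first-step recursion -/

/-- **Monotonicity** of a path functional `F` pinned by the first-step recursion
`F 0 x G = G [x]`, `F (T+1) x G = (∑_{y ∈ N x} F T y (l ↦ G (x :: l))) / #N x`. -/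
theorem mono (hF0 : ∀ x G, F 0 x G = G [x])
    (hFs : ∀ T x G, F (T + 1) x G = (∑ y ∈ N x, F T y (fun l => G (x :: l))) / ((N x).card : ℝ))
    (T : ℕ) (x : V) {G G' : List V → ℝ} (h : ∀ l, G l ≤ G' l) : F T x G ≤ F T x G' := by
  induction T generalizing x G G' with
  | zero => rw [hF0, hF0]; exact h _
  | succ T ih =>
    rw [hFs, hFs]
    exact div_le_div_of_nonneg_right
      (Finset.sum_le_sum fun y _ => ih y fun l => h (x :: l)) (Nat.cast_nonneg _)

/-- **Support**: `F T x G` only depends on the values of `G` at lists starting with `x`. -/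
theorem congr_start (hF0 : ∀ x G, F 0 x G = G [x])
    (hFs : ∀ T x G, F (T + 1) x G = (∑ y ∈ N x, F T y (fun l => G (x :: l))) / ((N x).card : ℝ))
    (T : ℕ) (x : V) {G G' : List V → ℝ} (h : ∀ l : List V, l.getD 0 v₀ = x → G l = G' l) :
    F T x G = F T x G' := by
  cases T with
  | zero => rw [hF0, hF0]; exact h _ List.getD_cons_zero
  | succ T =>
    rw [hFs, hFs]
    refine congrArg (· / _) (Finset.sum_congr rfl fun y _ => congrArg _ (funext fun l => ?_))
    exact h _ List.getD_cons_zero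

/-- **Mass**: if `N` is symmetric, the total mass of `F T x` is `1` from every start `x` with
`N x ≠ ∅` (every site entered has a neighbour, namely the previous site). -/
theorem mass_one (hF0 : ∀ x G, F 0 x G = G [x])
    (hFs : ∀ T x G, F (T + 1) x G = (∑ y ∈ N x, F T y (fun l => G (x :: l))) / ((N x).card : ℝ))
    (hsymm : ∀ x y, y ∈ N x → x ∈ N y) (T : ℕ) (x : V) (hx : (N x).Nonempty) :
    F T x (fun _ => 1) = 1 := by
  induction T generalizing x with
  | zero => rw [hF0]
  | succ T ih =>
    have hn : ((N x).card : ℝ) ≠ 0 := by exact_mod_cast hx.card_pos.ne'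
    rw [hFs, Finset.sum_congr rfl fun y hy => ih y ⟨x, hsymm x y hy⟩, Finset.sum_const,
      nsmul_eq_mul, mul_one, div_self hn]

/-! ### The forward martingale with a free offset, and its exceedance indicator -/

/-- Consing, time `0`: `M^a_0(x :: l) = hgt x - a`. -/
theorem mf_cons_zero
    (hMf : ∀ a t l, Mf a t l = hgt (l.getD t v₀) - a - ∑ s ∈ Finset.range t, d (l.getD s v₀))
    (a : ℝ) (x : V) (l : List V) : Mf a 0 (x :: l) = hgt x - a := by
  rw [hMf, List.getD_cons_zero, Finset.range_zero, Finset.sum_empty, sub_zero]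

/-- Consing, later times: `M^a_{t+1}(x :: l) = M^{a + d x}_t(l)` (the offset absorbs the drift of
the first step). -/
theorem mf_cons_succ
    (hMf : ∀ a t l, Mf a t l = hgt (l.getD t v₀) - a - ∑ s ∈ Finset.range t, d (l.getD s v₀))
    (a : ℝ) (t : ℕ) (x : V) (l : List V) : Mf a (t + 1) (x :: l) = Mf (a + d x) t l := by
  rw [hMf, hMf, Finset.sum_range_succ', List.getD_cons_succ, List.getD_cons_zero]
  simp only [List.getD_cons_succ]
  ring

/-- The exceedance indicator takes values in `[0, 1]`: upper bound. -/
theorem ind_le_one (hind : ∀ a l, ind a l = if ∃ t < l.length, lam ≤ |Mf a t l| then 1 else 0)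
    (a : ℝ) (l : List V) : ind a l ≤ 1 := by
  rw [hind]; split_ifs <;> norm_num

/-- The exceedance indicator of the empty path vanishes. -/
theorem ind_nil (hind : ∀ a l, ind a l = if ∃ t < l.length, lam ≤ |Mf a t l| then 1 else 0)
    (a : ℝ) : ind a [] = 0 := by
  rw [hind, if_neg]
  simp

/-- Consing when the event already holds at time `0`: the indicator of `x :: l` is `1`. -/
theorem ind_cons_of_le
    (hMf : ∀ a t l, Mf a t l = hgt (l.getD t v₀) - a - ∑ s ∈ Finset.range t, d (l.getD s v₀))
    (hind : ∀ a l, ind a l = if ∃ t < l.length, lam ≤ |Mf a t l| then 1 else 0)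
    {a : ℝ} {x : V} (h : lam ≤ |hgt x - a|) (l : List V) : ind a (x :: l) = 1 := by
  rw [hind, if_pos]
  exact ⟨0, by simp, by rwa [mf_cons_zero hMf]⟩

/-- Consing when the event fails at time `0`: the indicator of `x :: l` with offset `a` is the
indicator of `l` with offset `a + d x`. -/
theorem ind_cons_of_lt
    (hMf : ∀ a t l, Mf a t l = hgt (l.getD t v₀) - a - ∑ s ∈ Finset.range t, d (l.getD s v₀))
    (hind : ∀ a l, ind a l = if ∃ t < l.length, lam ≤ |Mf a t l| then 1 else 0)
    {a : ℝ} {x : V} (h : |hgt x - a| < lam) (l : List V) : ind a (x :: l) = ind (a + d x) l := by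
  rw [hind, hind]
  refine if_congr ⟨?_, ?_⟩ rfl rfl
  · rintro ⟨t, ht, hle⟩
    cases t with
    | zero => rw [mf_cons_zero hMf] at hle; exact absurd hle (not_le.mpr h)
    | succ t =>
      rw [List.length_cons] at ht
      exact ⟨t, by omega, by rwa [mf_cons_succ hMf] at hle⟩
  · rintro ⟨t, ht, hle⟩
    exact ⟨t + 1, by rw [List.length_cons]; omega, by rwa [mf_cons_succ hMf]⟩

/-! ### Orthogonality of the one-step increment -/

/-- The drift is an average of numbers in `[-1, 1]`, so `|d x| ≤ 1` (at a site with a neighbour). -/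
theorem abs_d_le_one (hd : ∀ x, d x = (∑ y ∈ N x, (hgt y - hgt x)) / ((N x).card : ℝ))
    (hbd : ∀ x, ∀ y ∈ N x, |hgt y - hgt x| ≤ 1) (x : V) (hx : (N x).Nonempty) : |d x| ≤ 1 := by
  have hn : (0 : ℝ) < (N x).card := by exact_mod_cast hx.card_pos
  rw [hd, abs_div, abs_of_pos hn, div_le_one hn]
  calc |∑ y ∈ N x, (hgt y - hgt x)| ≤ ∑ y ∈ N x, |hgt y - hgt x| :=
        Finset.abs_sum_le_sum_abs _ _
    _ ≤ ∑ _y ∈ N x, (1 : ℝ) := Finset.sum_le_sum (hbd x)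
    _ = (N x).card := by rw [Finset.sum_const, nsmul_eq_mul, mul_one]

/-- **Orthogonality of the martingale increment.**  With `n = #N x ≥ 1`:
`n (hgt x - a)² ≤ ∑_{y ∈ N x} (hgt y - (a + d x))² ≤ n (hgt x - a)² + 4 n`, because
`∑_y (hgt y - (a + d x))² = n (hgt x - a)² + ∑_y (hgt y - hgt x - d x)²` (the cross term
`2 (hgt x - a) ∑_y (hgt y - hgt x - d x)` vanishes by the definition of `d x`) and
`|hgt y - hgt x - d x| ≤ 2`. -/
theorem orthogonality (hd : ∀ x, d x = (∑ y ∈ N x, (hgt y - hgt x)) / ((N x).card : ℝ))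
    (hbd : ∀ x, ∀ y ∈ N x, |hgt y - hgt x| ≤ 1) (x : V) (hx : (N x).Nonempty) (a : ℝ) :
    ((N x).card : ℝ) * (hgt x - a) ^ 2 ≤ ∑ y ∈ N x, (hgt y - (a + d x)) ^ 2 ∧
      ∑ y ∈ N x, (hgt y - (a + d x)) ^ 2 ≤ ((N x).card : ℝ) * (hgt x - a) ^ 2 + 4 * (N x).card := by
  have hn : (0 : ℝ) < (N x).card := by exact_mod_cast hx.card_pos
  have hsum : ∑ y ∈ N x, (hgt y - hgt x) = (N x).card * d x := by
    rw [hd x, mul_div_cancel₀ _ hn.ne']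
  have key : ∑ y ∈ N x, (hgt y - (a + d x)) ^ 2 =
      (N x).card * (hgt x - a) ^ 2 + ∑ y ∈ N x, (hgt y - hgt x - d x) ^ 2 := by
    have e : ∀ y, (hgt y - (a + d x)) ^ 2 = (hgt y - hgt x - d x) ^ 2 +
        2 * (hgt x - a) * (hgt y - hgt x) + ((hgt x - a) ^ 2 - 2 * (hgt x - a) * d x) := by
      intro y; ring
    rw [Finset.sum_congr rfl fun y _ => e y, Finset.sum_add_distrib, Finset.sum_add_distrib,
      ← Finset.mul_sum, hsum, Finset.sum_const, nsmul_eq_mul]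
    ring
  have hW0 : 0 ≤ ∑ y ∈ N x, (hgt y - hgt x - d x) ^ 2 := Finset.sum_nonneg fun y _ => sq_nonneg _
  have hW4 : ∑ y ∈ N x, (hgt y - hgt x - d x) ^ 2 ≤ 4 * (N x).card := by
    have hdx := abs_le.mp (abs_d_le_one hd hbd x hx)
    calc ∑ y ∈ N x, (hgt y - hgt x - d x) ^ 2 ≤ ∑ _y ∈ N x, (4 : ℝ) :=
          Finset.sum_le_sum fun y hy => by
            have h1 := abs_le.mp (hbd x y hy)
            nlinarith [h1.1, h1.2, hdx.1, hdx.2]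
      _ = 4 * (N x).card := by rw [Finset.sum_const, nsmul_eq_mul, mul_comm]
  rw [key]
  exact ⟨le_add_of_nonneg_right hW0, by linarith⟩

/-! ### Second moment of the forward martingale -/

/-- **Second moment**: from a start `x` with `N x ≠ ∅` and for every offset `a`,
`(hgt x - a)² ≤ E_x[(M^a_T)²] ≤ (hgt x - a)² + 4T` (induction on `T`: first-step recursion, consing
`M^a_{T+1}(x :: l) = M^{a + d x}_T(l)`, the induction hypothesis at `(y, a + d x)` and
`orthogonality`). -/
theorem second_moment (hF0 : ∀ x G, F 0 x G = G [x])
    (hFs : ∀ T x G, F (T + 1) x G = (∑ y ∈ N x, F T y (fun l => G (x :: l))) / ((N x).card : ℝ))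
    (hsymm : ∀ x y, y ∈ N x → x ∈ N y)
    (hd : ∀ x, d x = (∑ y ∈ N x, (hgt y - hgt x)) / ((N x).card : ℝ))
    (hbd : ∀ x, ∀ y ∈ N x, |hgt y - hgt x| ≤ 1)
    (hMf : ∀ a t l, Mf a t l = hgt (l.getD t v₀) - a - ∑ s ∈ Finset.range t, d (l.getD s v₀))
    (T : ℕ) (x : V) (hx : (N x).Nonempty) (a : ℝ) :
    (hgt x - a) ^ 2 ≤ F T x (fun l => Mf a T l ^ 2) ∧
      F T x (fun l => Mf a T l ^ 2) ≤ (hgt x - a) ^ 2 + 4 * T := by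
  induction T generalizing x a with
  | zero =>
    rw [hF0, mf_cons_zero hMf]
    simp
  | succ T ih =>
    have hn : (0 : ℝ) < (N x).card := by exact_mod_cast hx.card_pos
    rw [hFs]
    simp only [mf_cons_succ hMf]
    have ih' : ∀ y ∈ N x, (hgt y - (a + d x)) ^ 2 ≤ F T y (fun l => Mf (a + d x) T l ^ 2) ∧
        F T y (fun l => Mf (a + d x) T l ^ 2) ≤ (hgt y - (a + d x)) ^ 2 + 4 * T :=
      fun y hy => ih y ⟨x, hsymm x y hy⟩ (a + d x)
    have horth := orthogonality hd hbd x hx a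
    have hlo : ∑ y ∈ N x, (hgt y - (a + d x)) ^ 2 ≤
        ∑ y ∈ N x, F T y (fun l => Mf (a + d x) T l ^ 2) :=
      Finset.sum_le_sum fun y hy => (ih' y hy).1
    have hhi : ∑ y ∈ N x, F T y (fun l => Mf (a + d x) T l ^ 2) ≤
        ∑ y ∈ N x, (hgt y - (a + d x)) ^ 2 + 4 * T * (N x).card := by
      calc ∑ y ∈ N x, F T y (fun l => Mf (a + d x) T l ^ 2)
          ≤ ∑ y ∈ N x, ((hgt y - (a + d x)) ^ 2 + 4 * T) :=
            Finset.sum_le_sum fun y hy => (ih' y hy).2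
        _ = ∑ y ∈ N x, (hgt y - (a + d x)) ^ 2 + 4 * T * (N x).card := by
            rw [Finset.sum_add_distrib, Finset.sum_const, nsmul_eq_mul]; ring
    constructor
    · rw [le_div_iff₀ hn]; linarith [horth.1]
    · rw [div_le_iff₀ hn]; push_cast; linarith [horth.2]

/-! ### Kolmogorov's maximal inequality by first-step analysis -/

/-- **Kolmogorov's inequality, offset form**: from a start `x` with `N x ≠ ∅`, for `λ > 0` and every
offset `a`, `λ² · E_x[1_{∃ t ≤ T, λ ≤ |M^a_t|}] ≤ E_x[1_{∃ t ≤ T, λ ≤ |M^a_t|} · (M^a_T)²]`.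
Induction on `T`.  If `λ ≤ |hgt x - a|` the indicator is `1` on every path from `x`, the left side
is `λ²` (mass one) and the right side is `E_x[(M^a_T)²] ≥ (hgt x - a)² ≥ λ²` (`second_moment`).
Otherwise the event fails at time `0`, both functionals of `x :: l` are the corresponding
functionals of `l` with offset `a + d x` (`ind_cons_of_lt`, `mf_cons_succ`), and the first-step
recursion plus the induction hypothesis at `(y, a + d x)` conclude. -/
theorem kolmogorov (hF0 : ∀ x G, F 0 x G = G [x])
    (hFs : ∀ T x G, F (T + 1) x G = (∑ y ∈ N x, F T y (fun l => G (x :: l))) / ((N x).card : ℝ))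
    (hsymm : ∀ x y, y ∈ N x → x ∈ N y)
    (hd : ∀ x, d x = (∑ y ∈ N x, (hgt y - hgt x)) / ((N x).card : ℝ))
    (hbd : ∀ x, ∀ y ∈ N x, |hgt y - hgt x| ≤ 1)
    (hMf : ∀ a t l, Mf a t l = hgt (l.getD t v₀) - a - ∑ s ∈ Finset.range t, d (l.getD s v₀))
    (hind : ∀ a l, ind a l = if ∃ t < l.length, lam ≤ |Mf a t l| then 1 else 0)
    (hlam : 0 < lam) (T : ℕ) (x : V) (hx : (N x).Nonempty) (a : ℝ) :
    lam ^ 2 * F T x (ind a) ≤ F T x (fun l => ind a l * Mf a T l ^ 2) := by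
  induction T generalizing x a with
  | zero =>
    rw [hF0, hF0, mf_cons_zero hMf]
    by_cases h : lam ≤ |hgt x - a|
    · rw [ind_cons_of_le hMf hind h, mul_one, one_mul]
      exact (pow_le_pow_left₀ hlam.le h 2).trans_eq (sq_abs _)
    · rw [ind_cons_of_lt hMf hind (not_le.mp h), ind_nil hind]
      simp
  | succ T ih =>
    have hn : (0 : ℝ) < (N x).card := by exact_mod_cast hx.card_pos
    by_cases h : lam ≤ |hgt x - a|
    · -- the event holds at time `0` on every path from `x`
      have hU : F (T + 1) x (ind a) = 1 := by
        rw [hFs]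
        simp only [ind_cons_of_le hMf hind h]
        rw [Finset.sum_congr rfl fun y hy => mass_one hF0 hFs hsymm T y ⟨x, hsymm x y hy⟩,
          Finset.sum_const, nsmul_eq_mul, mul_one, div_self hn.ne']
      have hQ : F (T + 1) x (fun l => ind a l * Mf a (T + 1) l ^ 2) =
          F (T + 1) x (fun l => Mf a (T + 1) l ^ 2) := by
        rw [hFs, hFs]
        simp only [ind_cons_of_le hMf hind h, one_mul]
      rw [hU, hQ, mul_one]
      calc lam ^ 2 ≤ |hgt x - a| ^ 2 := pow_le_pow_left₀ hlam.le h 2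
        _ = (hgt x - a) ^ 2 := sq_abs _
        _ ≤ F (T + 1) x (fun l => Mf a (T + 1) l ^ 2) :=
          (second_moment hF0 hFs hsymm hd hbd hMf (T + 1) x hx a).1
    · -- the event fails at time `0`: first-step recursion and the induction hypothesis
      have h' := not_le.mp h
      rw [hFs, hFs]
      simp only [ind_cons_of_lt hMf hind h', mf_cons_succ hMf]
      rw [mul_div_assoc', Finset.mul_sum]
      exact div_le_div_of_nonneg_right
        (Finset.sum_le_sum fun y hy => ih y ⟨x, hsymm x y hy⟩ (a + d x)) hn.le

/-- **The stub in the abstract setting.**  For a symmetric neighbour structure `N` on `V`, a height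
`hgt` with nearest-neighbour increments bounded by `1`, the drift `d` and a path functional `F`
pinned by the first-step recursion: from every start `x` with `N x ≠ ∅` and for every `λ > 0`,
`λ² · F T x (1_{∃ t ≤ T, λ ≤ |hgt x_t - hgt x_0 - ∑_{s<t} d x_s|}) ≤ 4T`
(`kolmogorov` and `second_moment` at the offset `a := hgt x`, monotonicity for
`1_{…} (M_T)² ≤ (M_T)²`, and `congr_start` to replace `hgt x_0` by `hgt x`). -/
theorem sq_mul_exceedance_le (hF0 : ∀ x G, F 0 x G = G [x])
    (hFs : ∀ T x G, F (T + 1) x G = (∑ y ∈ N x, F T y (fun l => G (x :: l))) / ((N x).card : ℝ))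
    (hsymm : ∀ x y, y ∈ N x → x ∈ N y)
    (hd : ∀ x, d x = (∑ y ∈ N x, (hgt y - hgt x)) / ((N x).card : ℝ))
    (hbd : ∀ x, ∀ y ∈ N x, |hgt y - hgt x| ≤ 1)
    (hMf : ∀ a t l, Mf a t l = hgt (l.getD t v₀) - a - ∑ s ∈ Finset.range t, d (l.getD s v₀))
    (hind : ∀ a l, ind a l = if ∃ t < l.length, lam ≤ |Mf a t l| then 1 else 0)
    (hlam : 0 < lam) (T : ℕ) (x : V) (hx : (N x).Nonempty) :
    lam ^ 2 * F T x (fun l => if ∃ t < l.length,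
        lam ≤ |hgt (l.getD t v₀) - hgt (l.getD 0 v₀) - ∑ s ∈ Finset.range t, d (l.getD s v₀)|
        then (1 : ℝ) else 0) ≤ 4 * T := by
  have hE : F T x (fun l => if ∃ t < l.length,
        lam ≤ |hgt (l.getD t v₀) - hgt (l.getD 0 v₀) - ∑ s ∈ Finset.range t, d (l.getD s v₀)|
        then (1 : ℝ) else 0) = F T x (ind (hgt x)) := by
    refine congr_start (v₀ := v₀) hF0 hFs T x fun l hl => ?_
    rw [hind]
    refine if_congr ?_ rfl rfl
    simp only [hMf, hl]
  have h1 := kolmogorov hF0 hFs hsymm hd hbd hMf hind hlam T x hx (hgt x)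
  have h2 : F T x (fun l => ind (hgt x) l * Mf (hgt x) T l ^ 2) ≤
      F T x (fun l => Mf (hgt x) T l ^ 2) :=
    mono hF0 hFs T x fun l => mul_le_of_le_one_left (sq_nonneg _) (ind_le_one hind _ l)
  have h3 := (second_moment hF0 hFs hsymm hd hbd hMf T x hx (hgt x)).2
  rw [hE]
  linarith

end StubForwardKolmogorov

open StubForwardKolmogorov in
/-- **Stub `stub_forwardKolmogorov`** of the crux `VerticalGamblersRuin` (line `registered`, rev 8;
exact registered signature): **quenched Kolmogorov maximal inequality for the forward martingale of
the height.**  `D ω z` is the local vertical drift of the SRW at `z` (mean height increment of one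
step along the open lattice edges of `ω`; `0` at a site without open neighbour), `E ω T x G` the
expectation of `G [X_0, …, X_T]` for the SRW on the open lattice edges of `ω` started at `x`, both
pinned by their defining equations.  For the path `l`, `M_t(l) = h(x_t) - h(x_0) - Σ_{s<t} D ω x_s`;
then for `λ > 0` and a start `x` with an open lattice neighbour,
`λ² · E ω T x (1_{∃ t ≤ T, λ ≤ |M_t|}) ≤ 4T`.  Proof: `StubForwardKolmogorov.sq_mul_exceedance_le`
for `V = ℤ³`, `N x = N_ω(x)` (symmetric: adjacency is symmetric and `s(x, y) = s(y, x)`),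
`hgt z = z₀` (nearest-neighbour increments bounded by `1`, `SlabVoltage.apply_zero_le_of_adj`),
`d = D ω`, `F = E ω`. -/
theorem stub_forwardKolmogorov :
    ∀ D : BondConfig (Site 3) → Site 3 → ℝ,
      (∀ ω (z : Site 3), D ω z =
        (∑ y ∈ ((zdGraph 3).neighborFinset z).filter (fun y => s(z, y) ∈ ω),
            ((((y 0 : ℤ) : ℝ)) - ((z 0 : ℤ) : ℝ))) /
          ((((zdGraph 3).neighborFinset z).filter (fun y => s(z, y) ∈ ω)).card : ℝ)) →
    ∀ E : BondConfig (Site 3) → ℕ → Site 3 → (List (Site 3) → ℝ) → ℝ,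
      (∀ ω (x : Site 3) (G : List (Site 3) → ℝ), E ω 0 x G = G [x]) →
      (∀ ω (T : ℕ) (x : Site 3) (G : List (Site 3) → ℝ), E ω (T + 1) x G =
        (∑ y ∈ ((zdGraph 3).neighborFinset x).filter (fun y => s(x, y) ∈ ω),
            E ω T y (fun l => G (x :: l))) /
          ((((zdGraph 3).neighborFinset x).filter (fun y => s(x, y) ∈ ω)).card : ℝ)) →
    ∀ (ω : BondConfig (Site 3)) (T : ℕ) (x : Site 3) (lam : ℝ), 0 < lam →
      1 ≤ (((zdGraph 3).neighborFinset x).filter (fun y => s(x, y) ∈ ω)).card →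
      lam ^ 2 * E ω T x (fun l => if ∃ t < l.length,
          lam ≤ |(((l.getD t 0) 0 : ℤ) : ℝ) - (((l.getD 0 0) 0 : ℤ) : ℝ) -
            ∑ s ∈ Finset.range t, D ω (l.getD s 0)| then (1 : ℝ) else 0) ≤ 4 * T := by
  intro D hD E hE0 hEs ω T x lam hlam hx
  have hsymm : ∀ x' y : Site 3, y ∈ ((zdGraph 3).neighborFinset x').filter (fun y => s(x', y) ∈ ω) →
      x' ∈ ((zdGraph 3).neighborFinset y).filter (fun y' => s(y, y') ∈ ω) := by
    intro x' y hy
    rw [Finset.mem_filter, SimpleGraph.mem_neighborFinset] at hy ⊢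
    exact ⟨hy.1.symm, by rw [Sym2.eq_swap]; exact hy.2⟩
  have hbd : ∀ x' : Site 3, ∀ y ∈ ((zdGraph 3).neighborFinset x').filter (fun y => s(x', y) ∈ ω),
      |((y 0 : ℤ) : ℝ) - ((x' 0 : ℤ) : ℝ)| ≤ 1 := by
    intro x' y hy
    have hadj : (zdGraph 3).Adj x' y :=
      (SimpleGraph.mem_neighborFinset _ _ _).mp (Finset.mem_filter.mp hy).1
    have h1 : ((y 0 : ℤ) : ℝ) ≤ ((x' 0 : ℤ) : ℝ) + 1 := by
      exact_mod_cast SlabVoltage.apply_zero_le_of_adj hadj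
    have h2 : ((x' 0 : ℤ) : ℝ) ≤ ((y 0 : ℤ) : ℝ) + 1 := by
      exact_mod_cast SlabVoltage.apply_zero_le_of_adj hadj.symm
    rw [abs_le]
    constructor <;> linarith
  exact sq_mul_exceedance_le (v₀ := (0 : Site 3))
    (N := fun z => ((zdGraph 3).neighborFinset z).filter (fun y => s(z, y) ∈ ω)) (F := E ω)
    (hgt := fun z : Site 3 => ((z 0 : ℤ) : ℝ)) (d := D ω) (lam := lam)
    (Mf := fun a t l => (((l.getD t 0) 0 : ℤ) : ℝ) - a - ∑ s ∈ Finset.range t, D ω (l.getD s 0))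
    (ind := fun a l => if ∃ t < l.length,
      lam ≤ |(((l.getD t 0) 0 : ℤ) : ℝ) - a - ∑ s ∈ Finset.range t, D ω (l.getD s 0)|
      then (1 : ℝ) else 0)
    (hE0 ω) (hEs ω) hsymm (hD ω) hbd (fun _ _ _ => rfl) (fun _ _ => rfl) hlam T x
    (Finset.card_pos.mp hx)

end Summit.CriticalPhenomena.PercolationContinuityZ3.Theorems.VerticalGamblersRuin
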